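import Literature.MathematicalPhysics.QuantumFieldTheory.Balaban1983to89.B9Ineq349SiteFromBlocks
import Literature.MathematicalPhysics.QuantumFieldTheory.Balaban1983to89.B9Cor35ComparisonsGpCAtLetters

/-!
# `Balaban1983to89.B9Ineq349SiteAtOne` — T. Bałaban, *Propagators for lattice gauge theories in a background field*, Commun. Math. Phys. **99** (1985)
# 389–434 [Balaban1985BackgroundPropagators], (3.49) p. 399 with Cor. 3.5 p. 407 («for U = 1 these theorems are proved in [4]»): ROW 25 AT `U = 1` IS A
# THEOREM — the three block-complete input schemas of `B9Ineq349SiteComposite` HOLD at `U = 1` for every letter record with the printed `U = 1` clauses,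
# by [4]'s Propositions 2.2 ∕ 2.3 on the torus (certified in the tree) and the symmetry of `G′`; hence print's (3.49) display `B9.Ineq349` holds AT `U = 1`
# for the GENUINE site-sector `P = I − R` of def-Y's letters (all four entries; [4] prints only `∂P∂*`, (2.88))

statement-level skeleton of published theorems with citation tags; proofs where landed; nothing here is a claim about the Yang–Mills mass gap

THE PRINT.  [B9] p. 399 (3.49) (see `B9Ineq349SiteFromBlocks`); p. 395: *«It coincides with Δ_a in (2.19) if U = 1»*; Cor. 3.5 p. 407: *«for U = 1 these
theorems are proved in [4]»*.  [4] = [Balaban1984PropagatorsII]: Prop. 2.2 (2.67) p. 234 (the sup entries of `G′λ`, `∇G′λ`, `G′∂*λ` for `supp λ ⊂ B(y′)`),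
Prop. 2.3 (2.87) p. 238 (the kernel of `(Q′G′²Q′*)⁻¹`), (2.88) p. 238 (`∂P∂*` by the three-factor composition — the tree's `B6Ineq288MultiLevelTorus`).

WHAT IS PROVED (sorry-free; `𝔸` any complete normed ℂ-algebra; `parS`, `Gp` any letters with the printed clauses `parS(1) = 1`, `G′(1)(f ⊗ E) = (G′f) ⊗ E` —
the FIELDS `parS_one ∕ Gp_one` of def-Y's `CovLettersY`, so every record of record qualifies).
* §1 the `U = 1` formulas: `QpsY_one_deltaY` (`Q′*(1)(δ_{y₁}⊗F) = λ_{y₁} ⊗ F`, `λ_{y₁} = 1_{B(y₁)}` = [4]'s reader test function `lam`), `Gp_QpsY_one_deltaY`,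
  `qpK_G_apply` (`(Q′G′)(y₂, x′) = W(y₂)⁻¹(G′λ_{y₂})(x′)`, `G′` symmetric), `QpY_Gp_one_deltaY`, `QpY_Gp_cdsS_one_deltaY` (the adjoint-side factors ARE
  `W⁻¹·(D^bG′Q′*δ_{y₂})(x′)` — the tree's `right_entry`), `CY_one_norm_le`.
* §2 ★ `left342At_one`, ★ `right342At_one`, ★ `blk348At_one` — THE THREE SCHEMAS AT `U = 1` from [4]'s Prop. 2.2 (entries (2.67)₁,₂ at `λ_{y₁}`: the torus
  readings `abs_K1P_le ∕ abs_K3P_le` of `B6Ineq288MultiLevelTorus` and their `G′λ` analogues) and Prop. 2.3 ((2.87)), for a member above the census thresholds.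
* §3 ★★ `ineq349_fineEntryS_one` — (3.49) AT `U = 1` FOR EVERY k-LEVEL INDEX ABOVE A THRESHOLD: `∃ M⋆ θ C > 0, ∀ i, M⋆ ≤ L·M_h → ∀ 𝔸 parS Gp` (clauses) `∀ n y y′,
  fineEntryS i (P349Y i parS Gp) 1 y y′ n ≤ C·[1, ℓ⁻¹, ℓ⁻¹, ℓ⁻²]ₙ(y)·ℓ(y′)^{−d′}·e^{−θd(y,y′)}` — `prop22Printed_kLevelBT` + `prop23Printed_kLevelBT` + §2 +
  `B9Ineq349SiteFromBlocks.exists_threshold_349`; ★★★ `ineq349_p349SiteY_one` — AT THE RECORD GEOMETRY: `∃ M⋆ δ C > 0, ∀ x : MemberY, M⋆ ≤ (geo9Y x).M →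
  ∀ 𝔏 : CovLettersY 𝔸 x, B9.Ineq349 (d+1) (p349SiteY 𝔸 G x 𝔏) C δ (bg9Y 𝔸 G x).one` — ROW 25's DISPLAY HOLDS AT `U = 1` for every letter record (def-Y's
  `lettersYOfRecordDE 𝔯 x` included): the `U = 1` face of the genuine row 25, Cor. 3.5's sentence for (3.49).

HONEST SCOPE.  A `U = 1` statement (print's Cor. 3.5 territory), proved outright from [4]'s certified Props 2.2∕2.3; it does NOT prove (3.49) for `U ≠ 1`
(there the two inputs of `B9Ineq349SiteFromBlocks` remain hypotheses); count-neutral; NOT a node discharge; nothing continuum ∕ OS ∕ mass-gap.  Filed by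
dag-n06-i gen 6 (pub-ymgap N06 bundle F4, row 25); a NEW file; nothing landed is modified.
-/

namespace Literature.MathematicalPhysics.QuantumFieldTheory.Balaban1983to89.B9Ineq349SiteAtOne

open Node00
open B6KLevelCensusIndexV1 (KIdx)
open B6Geom246MultiLevelBox (bset blkOf)
open B6Ineq2142KLevelV1 (β)
open B6Ineq268MultiLevelBox (W W_pos)
open B6Prop22KLevelTorusCensus (KTIdx)
open B6Prop22KLevelTorusCensusEta (nKT nKT_pos)
open B6Prop22DerivMultiLevelTorus (dT)
open B6Ineq288MultiLevelTorus (geoBT gpBT CinvBT geoBT_M geoBT_len geoBT_dist lam K1 K1P abs_K1P_le right_entry GT_transpose dist_symm_geoBT lam_suppIn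
  supNorm_lam_le prop22Printed_kLevelBT prop23Printed_kLevelBT)
open B6 (pref4)
open B9Ineq349SiteReading (fineEntryS p349SiteY)
open B9Ineq349SiteComposite (lenB distB lenB_eq lenB_pos distB_nonneg etaS_pos Left342At Right342At Blk348At)
open B9Ineq349SiteFromBlocks (exists_threshold_349 geo9Y_len_eq_lenB geo9Y_dist_eq_distB geo9Y_M_eq p349SiteY_ker)
open B9Cor35ComparisonsGpCAtLetters (cdS_one_liftY cdsS_one_liftY)
open B9PinMembersKLevelV1 (MemberY geo9Y bg9Y)
open scoped Matrix

noncomputable section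

variable {d ℓ : ℕ} {hd : 1 ≤ d + 1} {hL : Odd (ℓ + 1) ∧ 1 < ℓ + 1} {b₀ b₁ : ℝ} {Mstar : ℕ}
variable {𝔸 : Type} [NormedRing 𝔸] [NormedAlgebra ℂ 𝔸] [CompleteSpace 𝔸]

/-! ## §1 The `U = 1` formulas for the factors of `P(1)` on deltas -/

section Formulas

variable (i : KIdx d ℓ hd hL b₀ b₁) {parS : SiteParY 𝔸 i} {Gp : SiteOpY 𝔸 i}
  (hparS : ∀ z w, parS (fun _ _ => 1) z w = 1)
  (hGp : ∀ (f : SiteY i → ℝ) (E : 𝔸), Gp (fun _ _ => 1) (liftY f E) = liftY ((toKT i).G *ᵥ f) E)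

/-- [4]'s reader test function `λ_{y₁} = Q′*δ_{y₁} = 1_{B(y₁)}` on the member's sites (`B6Ineq288MultiLevelTorus.lam` at the torus index `toKT i`,
re-typed on `SiteY i`). [cite: Balaban1984PropagatorsII, (2.88) p.238 («λ = Q′*δ_{y₁}»), dictionary] -/
def lamSY (s₁ : BlkY i) : SiteY i → ℝ := lam (toKT i).D s₁

/-- `supp λ_{y₁} ⊂ B(y₁)` in the census sense. [cite: Balaban1984PropagatorsII, Prop. 2.2 p.234 («supp λ ⊂ B^{j′}(y′)»)] -/
theorem lamSY_suppIn (s₁ : BlkY i) : (geoBT (toKT i)).suppIn (lamSY i s₁) s₁ := lam_suppIn (toKT i) s₁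

/-- `|λ_{y₁}| ≤ 1`. [cite: Balaban1984PropagatorsII, (2.3)–(2.4) p.224, bookkeeping] -/
theorem supNorm_lamSY_le (s₁ : BlkY i) : (geoBT (toKT i)).supNorm (lamSY i s₁) ≤ 1 := supNorm_lam_le (toKT i) s₁

omit [CompleteSpace 𝔸] in
/-- a delta is a product form: `δ_{x′} ⊗ E = 1_{x′} ⊗ E`. [cite: Balaban1985BackgroundPropagators, (3.48) p.398 (kernels), bookkeeping] -/
theorem deltaY_eq_liftY (x' : SiteY i) (E : 𝔸) : deltaY x' E = liftY (fun z => if z = x' then (1 : ℝ) else 0) E := by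
  classical
  funext z
  by_cases h : z = x'
  · simp [deltaY, liftY, h]
  · simp [deltaY, liftY, h]

include hparS in
/-- `Q′*(1)(δ_{y₁} ⊗ F) = λ_{y₁} ⊗ F`. [cite: Balaban1985BackgroundPropagators, (3.25) p.394 + p.395 («coincides … if U = 1»); Balaban1984PropagatorsII, (2.88) p.238] -/
theorem QpsY_one_deltaY (s₁ : BlkY i) (F : 𝔸) : QpsY i parS (fun _ _ => 1) (deltaY s₁ F) = liftY (lamSY i s₁) F := by
  classical
  rw [QpsY_one i hparS]
  funext z
  rw [liftMatY_apply, Finset.sum_eq_single s₁, liftY_apply]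
  · have hd : deltaY s₁ F s₁ = F := by simp [deltaY]
    rw [hd]
    rfl
  · intro s _ hs; simp [deltaY, hs]
  · intro h; exact absurd (Finset.mem_univ s₁) h

include hparS hGp in
/-- `G′(1)Q′*(1)(δ_{y₁} ⊗ F) = (G′λ_{y₁}) ⊗ F`. [cite: Balaban1985BackgroundPropagators, (3.25) p.394 + Cor. 3.5 p.407; Balaban1984PropagatorsII, (2.88) p.238] -/
theorem Gp_QpsY_one_deltaY (s₁ : BlkY i) (F : 𝔸) :
    Gp (fun _ _ => 1) (QpsY i parS (fun _ _ => 1) (deltaY s₁ F)) = liftY ((toKT i).G *ᵥ lamSY i s₁) F := by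
  rw [QpsY_one_deltaY i hparS, hGp]

/-- `G′` of the member is symmetric. [cite: Balaban1984PropagatorsII, p.225 («G′ = Δ′_a^{−1}», symmetric), bookkeeping] -/
theorem G_symm (a b : SiteY i) : (toKT i).G a b = (toKT i).G b a := by
  have h := congrFun (congrFun (GT_transpose (toKT i).D) b) a
  exact h

/-- a matrix on an indicator is its column: `(M·1_{x′})(y) = M(y, x′)`. [folklore] -/
private theorem mulVec_indicator {X Y : Type} [Fintype X] [DecidableEq X] (M : Matrix Y X ℝ) (x' : X) (y : Y) :
    (M *ᵥ fun z => if z = x' then (1 : ℝ) else 0) y = M y x' := by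
  simp only [Matrix.mulVec, dotProduct, mul_ite, mul_one, mul_zero, Finset.sum_ite_eq', Finset.mem_univ, if_true]

/-- **`(Q′G′)(y₂, x′) = W(y₂)⁻¹·(G′λ_{y₂})(x′)`** — the adjoint side, by the symmetry of `G′` (the `b = 0` twin of the tree's `right_entry`).
[cite: Balaban1984PropagatorsII, (2.88) p.238 («Q′G′ … = (G′Q′*)*»), Prop. 2.2 p.234] -/
theorem qpK_G_apply (y₂ : BlkY i) (x' : SiteY i) :
    (qpK i * (toKT i).G) y₂ x' = (W i.D.toDomains y₂)⁻¹ * ((toKT i).G *ᵥ lamSY i y₂) x' := by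
  rw [Matrix.mul_apply]
  simp only [Matrix.mulVec, dotProduct]
  rw [Finset.mul_sum]
  refine Finset.sum_congr rfl fun z _ => ?_
  show (if blkOf i.D.toDomains z = y₂ then (W i.D.toDomains y₂)⁻¹ else 0) * (toKT i).G z x' =
    (W i.D.toDomains y₂)⁻¹ * ((toKT i).G x' z * (if blkOf i.D.toDomains z = y₂ then 1 else 0))
  split_ifs with h
  · rw [G_symm i z x']; ring
  · ring

/-- **`(Q′G′∂*_ν)(y₂, x′) = W(y₂)⁻¹·(∂_νG′λ_{y₂})(x′)`** — the tree's `right_entry`, re-typed. [cite: Balaban1984PropagatorsII, (2.88) p.238] -/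
theorem qpK_G_dTt_apply (ν : Fin (d + 1)) (y₂ : BlkY i) (x' : SiteY i) :
    (qpK i * (toKT i).G * (dT (toKT i).NB ν)ᵀ) y₂ x' = (W i.D.toDomains y₂)⁻¹ * ((dT (toKT i).NB ν * (toKT i).G) *ᵥ lamSY i y₂) x' :=
  right_entry (toKT i).D ν y₂ x'

include hparS hGp in
/-- **`(Q′(1)G′(1)(δ_{x′} ⊗ E))(y₂) = (W(y₂)⁻¹(G′λ_{y₂})(x′)) • E`**. [cite: Balaban1985BackgroundPropagators, (3.25) p.394 + Cor. 3.5 p.407; Balaban1984PropagatorsII, (2.88) p.238] -/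
theorem QpY_Gp_one_deltaY (x' : SiteY i) (E : 𝔸) (y₂ : BlkY i) :
    QpY i parS (fun _ _ => 1) (Gp (fun _ _ => 1) (deltaY x' E)) y₂ =
      ((((W i.D.toDomains y₂)⁻¹ * ((toKT i).G *ᵥ lamSY i y₂) x' : ℝ)) : ℂ) • E := by
  classical
  rw [deltaY_eq_liftY, hGp, QpY_one i hparS, liftMatY_liftY, Matrix.mulVec_mulVec, liftY_apply, mulVec_indicator, qpK_G_apply]

include hparS hGp in
/-- **`(Q′(1)G′(1)∇*_{1,ν}(δ_{x′} ⊗ E))(y₂) = (W(y₂)⁻¹(∂_νG′λ_{y₂})(x′)) • E`**. [cite: Balaban1985BackgroundPropagators, (3.25) p.394 + Cor. 3.5 p.407; Balaban1984PropagatorsII, (2.88) p.238] -/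
theorem QpY_Gp_cdsS_one_deltaY (x' : SiteY i) (E : 𝔸) (ν : Fin (d + 1)) (y₂ : BlkY i) :
    QpY i parS (fun _ _ => 1) (Gp (fun _ _ => 1) (cdsS i (fun _ _ => 1) ν (deltaY x' E))) y₂ =
      ((((W i.D.toDomains y₂)⁻¹ * ((dT (toKT i).NB ν * (toKT i).G) *ᵥ lamSY i y₂) x' : ℝ)) : ℂ) • E := by
  classical
  rw [deltaY_eq_liftY, cdsS_one_liftY, hGp, QpY_one i hparS, liftMatY_liftY, Matrix.mulVec_mulVec, Matrix.mulVec_mulVec, liftY_apply,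
    mulVec_indicator, qpK_G_dTt_apply]

include hparS hGp in
/-- `‖(C(1)(δ_{y₂} ⊗ F))(y₁)‖ ≤ |(Q′G′²Q′*)⁻¹(1; y₁, y₂)|` ((2.87) kernel, print's units) for `‖F‖ ≤ 1`. [cite: Balaban1985BackgroundPropagators, (3.48) p.398 + Cor. 3.5 p.407; Balaban1984PropagatorsII, (2.87) p.238] -/
theorem CY_one_norm_le (s₁ s₂ : BlkY i) (F : 𝔸) (hF : ‖F‖ ≤ 1) :
    ‖CY i parS Gp (fun _ _ => 1) (deltaY s₂ F) s₁‖ ≤ |(CinvBT (toKT i)).ker s₁ s₂| := by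
  rw [CY_one_deltaY i hparS hGp, norm_smul, Complex.norm_real, Real.norm_eq_abs]
  exact (mul_le_mul_of_nonneg_left hF (abs_nonneg _)).trans_eq (mul_one _)

end Formulas

/-! ## §2 The three block-complete schemas at `U = 1` from [4]'s Propositions 2.2 ∕ 2.3 -/

section SchemasAtOne

variable (i : KIdx d ℓ hd hL b₀ b₁) {parS : SiteParY 𝔸 i} {Gp : SiteOpY 𝔸 i}
  (hparS : ∀ z w, parS (fun _ _ => 1) z w = 1)
  (hGp : ∀ (f : SiteY i → ℝ) (E : 𝔸), Gp (fun _ _ => 1) (liftY f E) = liftY ((toKT i).G *ᵥ f) E)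

/-- the print-unit (2.67)₁ reading at its own points: `η²|(G′λ)(x)| ≤ (gpBT i).e 0 λ y` for `x ∈ B(y)`. [cite: Balaban1984PropagatorsII, Prop. 2.2 (2.67) p.234, bookkeeping] -/
theorem etaS_sq_abs_G_le (f : SiteY i → ℝ) (x : SiteY i) (s : BlkY i) (hx : blkOf i.D.toDomains x = s) :
    etaS i ^ 2 * |((toKT i).G *ᵥ f) x| ≤ (gpBT (toKT i)).e 0 f s := by
  classical
  have h0 : |((toKT i).G *ᵥ f) x| ≤ (toKT i).e0 f s := by
    unfold KTIdx.e0
    refine le_ciSup_of_le (Set.finite_range _).bddAbove x ?_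
    have hx' : blkOf (toKT i).D.toDomains x = s := hx
    rw [if_pos hx']
  show etaS i ^ 2 * |((toKT i).G *ᵥ f) x| ≤ ((((nKT (toKT i) : ℕ) : ℝ))⁻¹) ^ (B6Prop22KLevelCensusEta.epow 0) * (toKT i).gp.e 0 f s
  have he : (toKT i).gp.e 0 = (toKT i).e0 := rfl
  rw [he, show B6Prop22KLevelCensusEta.epow 0 = 2 from rfl]
  exact mul_le_mul_of_nonneg_left h0 (pow_nonneg (etaS_pos i).le _)

/-- the print-unit (2.67)₂ reading at its own points: `η|(∂_μG′λ)(x)| ≤ (gpBT i).e 1 λ y` for `x ∈ B(y)` (the tree's `abs_K1P_le`).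
[cite: Balaban1984PropagatorsII, Prop. 2.2 (2.67) p.234, (2.88) p.238, bookkeeping] -/
theorem etaS_abs_dG_le (μ : Fin (d + 1)) (x : SiteY i) (s s₁ : BlkY i) (hx : blkOf i.D.toDomains x = s) :
    etaS i * |((dT (toKT i).NB μ * (toKT i).G) *ᵥ lamSY i s₁) x| ≤ (gpBT (toKT i)).e 1 (lamSY i s₁) s := by
  have h := abs_K1P_le (toKT i) μ x s s₁
  have hx' : blkOf (toKT i).D.toDomains x = s := hx
  have hK : K1P (toKT i) μ x s s₁ = etaS i * ((dT (toKT i).NB μ * (toKT i).G) *ᵥ lamSY i s₁) x := by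
    show (((nKT (toKT i) : ℕ) : ℝ))⁻¹ * K1 (toKT i).D μ x s s₁ = _
    unfold K1
    rw [if_pos hx']
    rfl
  rw [hK, abs_mul, abs_of_pos (etaS_pos i)] at h
  exact h

include hparS hGp in
/-- ★ **THE LEFT (3.42) SCHEMA AT `U = 1`** from [4]'s Prop. 2.2 at the member (entries (2.67)₁,₂ at `λ_{y₁} = Q′*δ_{y₁}`, `supp λ_{y₁} ⊂ B(y₁)`, `|λ_{y₁}| ≤ 1`).
[cite: Balaban1985BackgroundPropagators, Thm 3.1 (3.42) p.397 + Cor. 3.5 p.407; Balaban1984PropagatorsII, Prop. 2.2 (2.67) p.234] -/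
theorem left342At_one {C δ₀ : ℝ} (hC : 0 ≤ C)
    (h22 : ∀ (n : Fin 4) (f : SiteY i → ℝ) (y y' : BlkY i), (geoBT (toKT i)).suppIn f y' →
      (gpBT (toKT i)).e n f y ≤ C * pref4 ((geoBT (toKT i)).len y) n * Real.exp (-(δ₀ / 2 * (geoBT (toKT i)).dist y y')) *
        (geoBT (toKT i)).supNorm f) :
    Left342At i parS Gp (fun _ _ => 1) C (δ₀ / 2) := by
  intro s s₁ F hF x hx
  have hbase : ∀ n : Fin 4, (gpBT (toKT i)).e n (lamSY i s₁) s ≤ C * pref4 (lenB i s) n * Real.exp (-(δ₀ / 2 * distB i s s₁)) := by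
    intro n
    have h := h22 n (lamSY i s₁) s s₁ (lamSY_suppIn i s₁)
    have hnn : 0 ≤ C * pref4 (lenB i s) n * Real.exp (-(δ₀ / 2 * distB i s s₁)) :=
      mul_nonneg (mul_nonneg hC (B6Prop26PrintedKLevelV1.pref4_nonneg (lenB_pos i s).le n)) (Real.exp_nonneg _)
    calc (gpBT (toKT i)).e n (lamSY i s₁) s
        ≤ C * pref4 (lenB i s) n * Real.exp (-(δ₀ / 2 * distB i s s₁)) * (geoBT (toKT i)).supNorm (lamSY i s₁) := h
      _ ≤ C * pref4 (lenB i s) n * Real.exp (-(δ₀ / 2 * distB i s s₁)) * 1 := mul_le_mul_of_nonneg_left (supNorm_lamSY_le i s₁) hnn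
      _ = _ := mul_one _
  have hF' : F ∈ Metric.closedBall (0 : 𝔸) 1 := mem_closedBall_zero_iff.2 hF
  refine ⟨?_, fun μ => ?_⟩
  · -- entry `|G′λ|`
    rw [Gp_QpsY_one_deltaY i hparS hGp]
    have h1 : etaS i ^ 2 * ‖liftY ((toKT i).G *ᵥ lamSY i s₁) F x‖ ≤ etaS i ^ 2 * |((toKT i).G *ᵥ lamSY i s₁) x| :=
      mul_le_mul_of_nonneg_left (norm_liftY_le _ ⟨F, hF'⟩ x) (pow_nonneg (etaS_pos i).le _)
    refine h1.trans ((etaS_sq_abs_G_le i _ x s hx).trans ?_)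
    exact (hbase 0).trans_eq (by simp [pref4])
  · -- entry `|∇G′λ|`
    rw [Gp_QpsY_one_deltaY i hparS hGp, cdS_one_liftY, Matrix.mulVec_mulVec]
    have h1 : etaS i * ‖liftY ((dT (toKT i).NB μ * (toKT i).G) *ᵥ lamSY i s₁) F x‖ ≤
        etaS i * |((dT (toKT i).NB μ * (toKT i).G) *ᵥ lamSY i s₁) x| :=
      mul_le_mul_of_nonneg_left (norm_liftY_le _ ⟨F, hF'⟩ x) (etaS_pos i).le
    refine h1.trans ((etaS_abs_dG_le i μ x s s₁ hx).trans ?_)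
    exact (hbase 1).trans_eq (by simp [pref4])

include hparS hGp in
/-- ★ **THE RIGHT (ADJOINT-SIDE) (3.42) SCHEMA AT `U = 1`** from [4]'s Prop. 2.2 and the symmetry of `G′` (`qpK_G_apply`, `qpK_G_dTt_apply`), the
distance symmetric. [cite: Balaban1985BackgroundPropagators, Thm 3.1 (3.42) p.397 + Cor. 3.5 p.407; Balaban1984PropagatorsII, Prop. 2.2 (2.67) p.234, (2.88) p.238] -/
theorem right342At_one {C δ₀ : ℝ} (hC : 0 ≤ C)
    (h22 : ∀ (n : Fin 4) (f : SiteY i → ℝ) (y y' : BlkY i), (geoBT (toKT i)).suppIn f y' →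
      (gpBT (toKT i)).e n f y ≤ C * pref4 ((geoBT (toKT i)).len y) n * Real.exp (-(δ₀ / 2 * (geoBT (toKT i)).dist y y')) *
        (geoBT (toKT i)).supNorm f) :
    Right342At i parS Gp (fun _ _ => 1) C (δ₀ / 2) := by
  intro s₂ s' x' hx' E hE
  have hW := W_pos i.D.toDomains s₂
  have hbase : ∀ n : Fin 4, (gpBT (toKT i)).e n (lamSY i s₂) s' ≤ C * pref4 (lenB i s') n * Real.exp (-(δ₀ / 2 * distB i s₂ s')) := by
    intro n
    have h := h22 n (lamSY i s₂) s' s₂ (lamSY_suppIn i s₂)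
    have hds : distB i s₂ s' = (geoBT (toKT i)).dist s' s₂ := dist_symm_geoBT (toKT i) s₂ s'
    rw [hds]
    have hnn : 0 ≤ C * pref4 (lenB i s') n * Real.exp (-(δ₀ / 2 * (geoBT (toKT i)).dist s' s₂)) :=
      mul_nonneg (mul_nonneg hC (B6Prop26PrintedKLevelV1.pref4_nonneg (lenB_pos i s').le n)) (Real.exp_nonneg _)
    calc (gpBT (toKT i)).e n (lamSY i s₂) s'
        ≤ C * pref4 (lenB i s') n * Real.exp (-(δ₀ / 2 * (geoBT (toKT i)).dist s' s₂)) * (geoBT (toKT i)).supNorm (lamSY i s₂) := h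
      _ ≤ C * pref4 (lenB i s') n * Real.exp (-(δ₀ / 2 * (geoBT (toKT i)).dist s' s₂)) * 1 :=
          mul_le_mul_of_nonneg_left (supNorm_lamSY_le i s₂) hnn
      _ = _ := mul_one _
  -- the scalar prefactor `W·η^e·‖(W⁻¹ r) • E‖ ≤ η^e |r|`
  have key : ∀ (t : ℝ), 0 ≤ t → ∀ r : ℝ, W i.D.toDomains s₂ * (t * ‖((((W i.D.toDomains s₂)⁻¹ * r : ℝ)) : ℂ) • E‖) ≤ t * |r| := by
    intro t ht r
    rw [norm_smul, Complex.norm_real, Real.norm_eq_abs, abs_mul, abs_of_pos (inv_pos.2 hW)]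
    calc W i.D.toDomains s₂ * (t * ((W i.D.toDomains s₂)⁻¹ * |r| * ‖E‖))
        = t * |r| * ‖E‖ := by field_simp
      _ ≤ t * |r| * 1 := mul_le_mul_of_nonneg_left hE (mul_nonneg ht (abs_nonneg _))
      _ = t * |r| := mul_one _
  refine ⟨?_, fun ν => ?_⟩
  · -- entry `|G′λ|` on the adjoint side
    rw [QpY_Gp_one_deltaY i hparS hGp]
    refine (key _ (pow_nonneg (etaS_pos i).le 2) _).trans ((etaS_sq_abs_G_le i (lamSY i s₂) x' s' hx').trans ?_)
    exact (hbase 0).trans_eq (by simp [pref4])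
  · -- entry `|∇G′λ|` on the adjoint side
    rw [QpY_Gp_cdsS_one_deltaY i hparS hGp]
    refine (key _ (etaS_pos i).le _).trans ((etaS_abs_dG_le i ν x' s' s₂ hx').trans ?_)
    exact (hbase 1).trans_eq (by simp [pref4])

include hparS hGp in
/-- ★ **THE (3.48) SCHEMA AT `U = 1`** from [4]'s Prop. 2.3 at the member (`C(1)` = the (2.87) kernel operator, def-Y's `CY_one_deltaY`).
[cite: Balaban1985BackgroundPropagators, Thm 3.2 (3.48) p.398 + Cor. 3.5 p.407; Balaban1984PropagatorsII, Prop. 2.3 (2.87) p.238] -/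
theorem blk348At_one {C δ₁ : ℝ}
    (h23 : ∀ y y' : BlkY i, |(CinvBT (toKT i)).ker y y'| ≤
      C * (geoBT (toKT i)).len y ^ (-(4 : ℝ)) * (geoBT (toKT i)).len y' ^ (-((d + 1 : ℕ) : ℝ)) * Real.exp (-(δ₁ / 2 * (geoBT (toKT i)).dist y y'))) :
    Blk348At i parS Gp (fun _ _ => 1) C (δ₁ / 2) := by
  intro s₁ s₂ F hF
  exact (CY_one_norm_le i hparS hGp s₁ s₂ F hF).trans (h23 s₁ s₂)

end SchemasAtOne

/-! ## §3 (3.49) at `U = 1`: for every index above a threshold, and at the record geometry -/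

section RowAtOne

/-- ★★ **(3.49) AT `U = 1` FOR THE GENUINE `P = I − R` OF EVERY LETTER PAIR WITH THE PRINTED CLAUSES, EVERY MEMBER ABOVE A THRESHOLD** — from [4]'s
Propositions 2.2 ∕ 2.3 on the torus (certified: `prop22Printed_kLevelBT`, `prop23Printed_kLevelBT`), the `U = 1` schemas of §2, and the derivation
`B9Ineq349SiteFromBlocks.exists_threshold_349`: `∃ M⋆ θ C > 0, ∀ i, M⋆ ≤ L·M_h → ∀ 𝔸 parS Gp` (clauses) `∀ n y y′, fineEntryS i (P349Y i parS Gp) 1 y y′ n ≤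
C·[1, ℓ(y)⁻¹, ℓ(y)⁻¹, ℓ(y)⁻²]ₙ·ℓ(y′)^{−d′}·e^{−θd(y,y′)}`.
[cite: Balaban1985BackgroundPropagators, (3.49) p.399 + Cor. 3.5 p.407; Balaban1984PropagatorsII, Prop. 2.2 p.234, Prop. 2.3 p.238, Lemma 2.1 p.234, (2.88) p.238] -/
theorem ineq349_fineEntryS_one :
    ∃ Mst θ C : ℝ, 0 < Mst ∧ 0 < θ ∧ 0 < C ∧
      ∀ i : KIdx d ℓ hd hL b₀ b₁, Mst ≤ ((ℓ : ℝ) + 1) * i.Mh →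
        ∀ {𝔸 : Type} [NormedRing 𝔸] [NormedAlgebra ℂ 𝔸] [CompleteSpace 𝔸] (parS : SiteParY 𝔸 i) (Gp : SiteOpY 𝔸 i),
          (∀ z w, parS (fun _ _ => 1) z w = 1) →
          (∀ (f : SiteY i → ℝ) (E : 𝔸), Gp (fun _ _ => 1) (liftY f E) = liftY ((toKT i).G *ᵥ f) E) →
          ∀ (n : Fin 4) (s s' : BlkY i), fineEntryS i (P349Y i parS Gp) (fun _ _ => 1) s s' n ≤
            C * B9.pref4inv (lenB i s) n * lenB i s' ^ (-((d + 1 : ℕ) : ℝ)) * Real.exp (-(θ * distB i s s')) := by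
  have hℓ1 : 1 ≤ ℓ := by have := hL.2; omega
  obtain ⟨M₁, δ₀, C₀, Cα, hM₁, hδ₀, hC₀, H22⟩ := prop22Printed_kLevelBT (d := d) hℓ1
  obtain ⟨M₂, δ₁, C₁, hM₂, hδ₁, hC₁, H23⟩ := prop23Printed_kLevelBT (d := d) hℓ1
  obtain ⟨M₃, θ, Cg, hM₃, hθ, hCg, -, H⟩ :=
    exists_threshold_349 (d := d) (ℓ := ℓ) (hd := hd) (hL := hL) (b₀ := b₀) (b₁ := b₁) (half_pos hδ₀) (half_pos hδ₁)
  refine ⟨max M₁ (max M₂ M₃), θ, C₀ * C₁ * C₀ * Cg, lt_max_of_lt_left hM₁, hθ, by positivity, ?_⟩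
  intro i hM 𝔸 _ _ _ parS Gp hparS hGp n s s'
  have hM1 : M₁ ≤ (geoBT (toKT i)).M := by rw [geoBT_M]; exact (le_max_left _ _).trans hM
  have hM2 : M₂ ≤ (geoBT (toKT i)).M := by rw [geoBT_M]; exact ((le_max_left _ _).trans (le_max_right _ _)).trans hM
  have hM3 : M₃ ≤ ((ℓ : ℝ) + 1) * i.Mh := ((le_max_right _ _).trans (le_max_right _ _)).trans hM
  have h22 := (H22 (toKT i) trivial hM1).1
  have h23 := H23 (toKT i) trivial hM2
  exact H i hM3 parS Gp (fun _ _ => 1) hC₀.le hC₁.le (left342At_one i hparS hGp hC₀.le h22) (right342At_one i hparS hGp hC₀.le h22)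
    (blk348At_one i hparS hGp h23) n s s'

variable (𝔸) (G : Subgroup 𝔸ˣ)

/-- ★★★ **ROW 25's DISPLAY HOLDS AT `U = 1` FOR EVERY LETTER RECORD AT THE RECORD GEOMETRY**: `∃ M⋆ δ C > 0, ∀ x : MemberY, M⋆ ≤ (geo9Y x).M →
∀ 𝔏 : CovLettersY 𝔸 x, B9.Ineq349 (d+1) (p349SiteY 𝔸 G x 𝔏) C δ (bg9Y 𝔸 G x).one` — the printed (3.49) for the GENUINE site-sector `P(1) = I − R(1)`
of `𝔏` (the clauses `parS_one`, `Gp_one` are fields of `CovLettersY`), read at the carrier blocks, PROVED from [4]: Cor. 3.5's «for U = 1 these theorems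
are proved in [4]» for (3.49), all four kernels (only `∂P∂*`, (2.88), is printed in [4]).  In particular for def-Y's `lettersYOfRecordDE N θ M⋆ 𝔯 x` — the
`U = 1` face of n06-i's row 25 at `opsYS349OfRecordDE`.
[cite: Balaban1985BackgroundPropagators, (3.49) p.399 + Cor. 3.5 p.407; Balaban1984PropagatorsII, Prop. 2.2 p.234, Prop. 2.3 p.238, (2.88) p.238] -/
theorem ineq349_p349SiteY_one :
    ∃ Mst δ C : ℝ, 0 < Mst ∧ 0 < δ ∧ 0 < C ∧
      ∀ x : MemberY d ℓ hd hL b₀ b₁ Mstar, Mst ≤ (geo9Y x).M →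
        ∀ 𝔏 : CovLettersY 𝔸 x, B9.Ineq349 (d + 1) (p349SiteY 𝔸 G x 𝔏) C δ (bg9Y 𝔸 G x).one := by
  obtain ⟨Mst, θ, C, hM, hθ, hC, H⟩ := ineq349_fineEntryS_one (d := d) (ℓ := ℓ) (hd := hd) (hL := hL) (b₀ := b₀) (b₁ := b₁)
  refine ⟨Mst, 2 * θ, C, hM, by positivity, hC, fun x hMx 𝔏 n b b' => ?_⟩
  have hM' : Mst ≤ ((ℓ : ℝ) + 1) * x.Mh := by rw [← geo9Y_M_eq]; exact hMx
  rw [p349SiteY_ker, geo9Y_len_eq_lenB, geo9Y_len_eq_lenB, geo9Y_dist_eq_distB, show 2 * θ / 2 = θ by ring]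
  exact H x.toKIdx hM' 𝔏.parS 𝔏.Gp 𝔏.parS_one 𝔏.Gp_one n _ _

end RowAtOne

end

end Literature.MathematicalPhysics.QuantumFieldTheory.Balaban1983to89.B9Ineq349SiteAtOne
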